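import Summits.BirchSwinnertonDyer.Rank1Residual.F1Sign2.TranspositionDoorAtTwo
import Summits.BirchSwinnertonDyer.Rank1Residual.F1Sign2.HeegnerEggAtTwo
import Literature.NumberTheory.EllipticCurves.HeegnerPoints
import HarnessLib

/-!
# Cell `bsd-f1-sign2`, lens `-an` g8 (MEMO-an v1.18 §2 AN-24): THE SINGLE DOOR AND THE `Δ < 0` SUPPLY THEOREM — AN-24S `TranspositionSupplyAtTwo`
# (theorem on paper: Chebotarev in the `S₄`-field of halves), the carrier `OnNegLocus`, and the PROVED composition with the door law AN-22K

STATEMENTS + PROVED bookkeeping (`OnNegLocus` a predicate; AN-24S `TranspositionSupplyAtTwo` a candidate THEOREM as a plain `def … : Prop` — unconditional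
field arithmetic + Chebotarev on paper, nothing asserted, no `@[conjecture]` tag (typer's discretion per the planner: same treatment as T-q₀ / IMC-LKε);
`exists_oddIndexDatum_of_doorLaw_of_supply` PROVED from its hypotheses; no named Literature fact, no `sorry`).

TYPER FILING (seat `bsd-f1-sign2-ty` g4, D-an-27; CANDIDATES.md rows AN-24S / AN-24 / D-an-NL): bodies VERBATIM from the planner's
`HOME/MEMO-an-data/g8/Sketch_v13.lean` c60c45dcebe31650 (-an g8 2026-08-28T02:03:06Z, MEMO-an v1.18 25eaa8f6f1c4f8d3, rows `CANDIDATES-rows-an-v118.md` 7bfe10b3bd779874;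
rc 0 / 0 sorry per -an; evidence #28 on stmt-BirchSwinnertonDyer-23715); namespace as in the sketch (`Summit.BirchSwinnertonDyer.Rank1Residual.F1Sign2.SingleDoor`);
imports as in the sketch (the landed `F1Sign2/TranspositionDoorAtTwo.lean` p593816 + `F1Sign2/HeegnerEggAtTwo.lean` + `Literature…HeegnerPoints`); the only edit is
this header. CENSUS of record (planner's): ENGINE I kit j296819 (all 118 243 Cremona #1 rank-1 odd-torsion `Δ < 0` curves, N < 10⁵; tranche S = supply witnesses
`(d, q₀)` with `|d| ≤ 10³` by two engines + cubic dictionary + PARI polgalois; predictions P24.1–P24.4 pre-registered) — RUNNING at filing time; results to the row.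
REF1-AUDIT-v1 §59 (92e4051c8ce026eb, 2026-08-28T02:42:46Z; evidence `HOME/REF1-data/b59/`): **AN-24S `TranspositionSupplyAtTwo` SURVIVES THEOREM-GRADE (in-print assembly: Kummer theory of `E[2]` + Chebotarev); `exists_oddIndexDatum_of_doorLaw_of_supply` PROVED with axioms {propext, Classical.choice, Quot.sound}; `OnNegLocus` = Iff.rfl bookkeeping; -ty CLEARED TO FILE.** Probe (sketch verbatim) rc 0 / 82 s; BC7 ∀×1 H×6 ⊢ ∃: P1 17.1 s / P2 0.3 / P2h 0.4 CLEAN; paper proof checked clause-by-clause against the typed `TranspAdmissible` / `SatisfiesHeegnerHypothesis` / `IsImaginaryQuadratic` / `MeetsNonNormAt` (d = q₀^*q₁^* meets every conjunct; (−1/q₁) = −(−1/q₀), (2/q₁) = (2/q₀) needed ALWAYS since d ≡ 1 mod 8, (ℓ/q₁) = (ℓ/q₀) forces (Δ/q₁) = (Δ/q₀)(−1)^{[Δ<0]} = +1 exactly when Δ < 0); REF2 §45(b)'s S₄ point is AUTOMATIC (Δ < 0 non-square + cubic irreducible ⇒ S₃; H¹(S₃, E[2]) = 0; non-zero Kummer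 class ⇒ E[2]⋊S₃ ≅ S₄ — no Jones–Rouse; census polgalois order 24 on 118 243/118 243); vacuity: 43a1 inhabits all binders, supply witnesses 118 243/118 243 (j296819); mutation: `Δ < 0` and `rank = 1` load-bearing (`= 1` weakenable to `1 ≤`), CM neither excluded nor needed; docstring nits n1–n3 folded in the decl docstring below. REF2-PLACEMENT v16 §45 (ee13753462ac1f7d, 2026-08-28T02:19:37Z, D-an-29 ANSWERED): (a) the AN-24 single-door reading = KNOWN ingredients, the unification a READING (corollary-grade): «α has a preimage under φⁿ over the residue field iff Frob fixes a point of U_n» is Jones–Rouse 2010 verbatim [corpus: arxiv-0706.2384 p0006 L20–28] (n = 1, φ = [2]); q₀ side non-norm ⟺ P₀ ∉ 2Ẽ(𝔽_{q₀}) = Kramer 1981 Prop. 3, Selmer drop = MR2010 Prop. 3.3 (§42); ∞ side = BK77 / Yoo–Yu (§44); **(b) AN-24S `TranspositionSupplyAtTwo` = IN-PRINT ASSEMBLY, theorem-grade small** (Chebotarev in ℚ(½P₀, √−1, √2, √ℓ); S₄'s unique index-2 subgroup ⇒ the intersection is ℚ(√Δ); sign = AN-22J) — theorem on paper AGREED;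 ONE audit point: the 4-cycle needs Gal(ℚ(½P₀)/ℚ) ≅ S₄ (A₄ has no 4-cycle) — assume it or cite Jones–Rouse 2010 Thm 5.2 (ℓ = 2 clause, p0015) for the surjectivity at level 1 under P₀ ∉ 2E(ℚ) + the H¹ condition; (c) `S_twistValueNeg` (line v5) = OPEN IN PRINT as a theorem, BSD₂-shadow; the «+1» ingredient is in print (Zhai 2016 Lemma [arxiv-1409.0231 p0006 L84]: ord₂ c_q(E^{(M)}) = ord₂ #E(ℚ_q)[2]). PARTITION: none moved; beyond-print theorem: no. bears_on: `stmt-BirchSwinnertonDyer-23715` (line egg-kolyvagin-two v5: stub_supply; the declared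
residual shrinks from {`Δ < 0` ∨ `Ш[2] ≠ 0` ∨ `ε = −1`} to {`Ш[2] ≠ 0` ∨ (`Δ > 0` ∧ `ε = −1`)}) and `stmt-BirchSwinnertonDyer-19099`.

Planner's summary (verbatim): # Sketch v13 (-an g8, MEMO-an v1.18 AN-24): THE SINGLE DOOR AND THE `Δ < 0` SUPPLY THEOREM

ONE DICTIONARY FOR BOTH SIGNS OF `Δ`.  Let `W/ℚ` be globally minimal with `E(ℚ)[2] = 0` and let `P₀ ∈ E(ℚ) ∖ 2E(ℚ)`
(rank one: the generator modulo odd torsion).  The field `L = ℚ(½P₀)` of halves of `P₀` has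
`Gal(L/ℚ) ≅ E[2] ⋊ S₃ ≅ S₄` acting on the four halves (`E[2]` is the irreducible `𝔽₂[S₃]`-module, `H¹(S₃, E[2]) = 0`,
and the Kummer class of `P₀` is non-zero).  For a place `v` of `ℚ` ramified in an imaginary quadratic `K = ℚ(√d)`
(`v = ∞` or `v = q ∣ d`, `q` odd of good reduction) Kramer's local norm index is `E(ℚ_v)/N E(K_w) ≅ E(ℚ_v)/2E(ℚ_v)`-part
`≅ Ẽ(𝔽_q)/2Ẽ(𝔽_q)` resp. `E(ℝ)/E⁰(ℝ)`, and

  «`P₀` is NOT a local norm at `v`»  ⟺  «`Frob_v` (resp. complex conjugation) has NO FIXED POINT on the 4-set `½P₀`».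

In `S₄` (class ↦ image in `S₃ = S₄/V₄` ↦ fixed points on `½P₀`): identity ↦ id ↦ 4; double transposition ↦ id ↦ 0;
transposition ↦ transposition ↦ 2; 4-cycle ↦ transposition ↦ 0; 3-cycle ↦ 3-cycle ↦ 1.  Hence:
* `v = ∞`, `Δ > 0` (`c` trivial on `E[2]`): door open ⟺ `c` = double transposition ⟺ `P₀ ∉ E⁰(ℝ)` ⟺ `MeetsEgg W` (ε = +1);
* `v = ∞`, `Δ < 0` (`c` a transposition on `E[2]`, order 2 ⇒ a transposition in `S₄`): door ALWAYS CLOSED (no egg);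
* `v = q`, `a_q` odd (3-cycle): `Ẽ(𝔽_q)[2] = 0`, no door (norm index 1);
* `v = q₀` a transposition prime (`(Δ/q₀) = −1`): door open ⟺ `Frob_{q₀}` is a 4-CYCLE ⟺ `MeetsNonNormAt W q₀`
  ⟺ the halving quartic `φ₂(x) − x(P₀)ψ₂(x)²` of `P₀` has no root mod `q₀` (ENGINE I of the census).
For a minimally ramified Heegner `d` (exactly one ramified place `v` with `E(ℚ_v)[2] ≠ 0`: `v = ∞` for -desc's
`DescAdmissible` at `Δ > 0`, `v = q₀` for `TranspAdmissible` at `Δ < 0`; Hilbert reciprocity = AN-22J forbids the other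
two combinations) Mazur–Rubin Prop. 3.3 reads `dim Sel₂(E^{(d)}) = 1 + 1 − 2·[door open]`, i.e. T-C / T-q₀, and the lens'
conjectures AN-21-LAW / AN-22K become ONE law: **the Heegner index `I_K` is odd iff the unique door is open.**

THE NEW THEOREM (AN-24S, this sketch): at `Δ < 0` THE DOOR CAN ALWAYS BE OPENED.  By Chebotarev in
`L·ℚ(√−1, √2, √ℓ : ℓ ∣ N odd)` (whose intersection with `ℚ(E[2])` is `ℚ(√Δ)`, and `√Δ` lies in the multiquadratic field
since `Δ` is supported on bad primes) there are infinitely many primes `q₀` with `Frob_{q₀}` a 4-cycle (density `1/4`) and,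
for each, a 3-cycle prime `q₁` with prescribed characters `(−1/·), (2/·), (ℓ/·)` — the one linear constraint on those
characters is `(Δ/q₁) = +1`, and the prescribed values satisfy it EXACTLY WHEN `Δ < 0` (the sign budget
`∏ (Δ/qᵢ) = sign Δ` of AN-22J).  Then `d = q₀^* q₁^*` is transposition-admissible with the door open at `q₀`.
So on `{Δ < 0, E(ℚ)[2] = 0, rank 1}` an admissible `K` with OPEN door always exists, whereas at `Δ > 0` the door bit
`ε(E)` is intrinsic (closed on ≈ 46 % of the slice).  Consequence for crux 23715 (line egg-kolyvagin-two v5): the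
declared residual shrinks from {`Δ < 0` ∨ `Ш[2] ≠ 0` ∨ `ε = −1`} to {`Ш[2] ≠ 0` ∨ (`Δ > 0` ∧ `ε = −1`)}.

Contents: `TranspositionSupplyAtTwo` (AN-24S, THEOREM on paper, typed; census ENGINE I = kit job of this generation),
`OnNegLocus` (carrier), and the kernel-checked composition `exists_oddIndexDatum_of_doorLaw_of_supply`: door law AN-22K +
supply AN-24S ⇒ on the `Δ < 0` locus there EXIST an admissible `K` and a transposition prime at which every odd-constant
Heegner point is not twice up to torsion (the input of the tree door `P2.bsdp_two_iff_of_heegner_rankOne` with `n = 1`).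
Nothing is asserted: two defs + one theorem proved from its hypotheses.  BSD is not proved by any of this.
LANDING NOTE (-ty g12, 2026-08-28T20:2xZ): AN-24S `TranspositionSupplyAtTwo` is a TREE THEOREM — `GenusKolyTransp.transpositionSupplyAtTwo_holds` (gk2-p4 g13, p663260); see its docstring.
-/


noncomputable section

open scoped Classical

namespace Summit.BirchSwinnertonDyer.Rank1Residual.F1Sign2.SingleDoor

open Literature.NumberTheory.EllipticCurves Literature.NumberTheory.EllipticCurves.ModularForms
  Summit.BirchSwinnertonDyer.Rank1Residual.F1Sign2
  Summit.BirchSwinnertonDyer.Rank1Residual.F1Sign2.TranspositionDoor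

set_option autoImplicit false

/-- The `Δ < 0` locus of the slice (the twin of `OnEggLocus`; NO door bit in it — the door is chosen, not suffered):
`Δ < 0`, `E(ℚ)[2] = 0`, `Ш(E)[2] = 0`, `∏ c_ℓ` odd. -/
def OnNegLocus (W : WeierstrassCurve ℚ) [W.IsElliptic] : Prop :=
  W.Δ < 0 ∧ NoRationalTwoTorsion W ∧ ShaTwoTrivial W ∧ ¬ 2 ∣ W.tamagawaProduct

/-- **AN-24S `TranspositionSupplyAtTwo` (THEOREM on paper: Chebotarev in the `S₄`-field `ℚ(½P₀)` composed with
`ℚ(√−1, √2, √ℓ : ℓ ∣ N odd)`; see the module docstring).**  For `W/ℚ` globally minimal with `Δ < 0`, `E(ℚ)[2] = 0` and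
rank one there is an imaginary quadratic `K`, `(d_K, N) = 1`, satisfying the Heegner hypothesis for `N`, whose
discriminant is transposition-admissible for some prime `q₀` AT WHICH THE DOOR IS OPEN (`E(ℚ)` meets Kramer's non-norm
coset: `P₀ mod q₀ ∉ 2Ẽ(𝔽_{q₀})`, i.e. `Frob_{q₀}` is a 4-cycle on `½P₀`).  Infinitely many such `(K, q₀)` exist; one is
stated.  Why it might fail: only through a slip in the `S₄` bookkeeping (the statement is unconditional field
arithmetic + Chebotarev); the Lean proof needs an imaginary quadratic field with prescribed discriminant as a `Type`
and prime splitting ⟺ Kronecker symbol, both routine but long.  Census ENGINE I (kit, this generation): for every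
`Δ < 0` curve of the table a witness `(d, q₀)` with `|d| ≤ 10³`, and the 4-cycle density among transposition primes.
REF1-AUDIT §59 notes: (n1) `Gal(ℚ(½P₀)/ℚ) ≅ S₄` is automatic here — `Δ < 0` non-square and the
2-division cubic irreducible give `Gal(ℚ(E[2])/ℚ) ≅ S₃`, `H¹(S₃, E[2]) = 0`, and the non-zero Kummer class of `P₀` restricts to a non-zero
`S₃`-homomorphism onto `E[2]`, so the group is `E[2] ⋊ S₃ ≅ S₄` (no Jones–Rouse input); (n2) the `(2/·)` prescription on `q₁` is needed
unconditionally, since `TranspAdmissible` demands `d ≡ 1 (mod 8)`; (n3) in the module text «exactly one ramified place `v` with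
`E(ℚ_v)[2] ≠ 0`» read «with `E(ℚ_v)/2E(ℚ_v) ≠ 0`».
LANDING NOTE (-ty g12, 2026-08-28): PROVED in the kernel with NO hypothesis left —
`Summit.BirchSwinnertonDyer.BirchSwinnertonDyer.Theorems.GenusKolyTransp.transpositionSupplyAtTwo_holds : TranspositionSupplyAtTwo`
(`Theorems/GenusKolyvaginAtTwoGenusPrimitiveSupplyAtTwoTranspositionSupply.lean`, bsd-line-gk2-p4 g13, p663260 ACCEPTED, commit d1e3132a5607: ℓ a Mazur–Rubin
twisting prime for κ(P₀) by the lead's Čebotarev theorem `exists_twistingPrime_not_mem_strictLocalKer`, ρ̄ onto from Dokchitser–Dokchitser (tree), (Δ/ℓ) = −1 by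
the lead's Jacobi parity; std axioms).  Users' `(h : TranspositionSupplyAtTwo)` binders are fed that theorem; this `def` stays as the binder name (append-only).
[cite: Kramer1981, Prop. 3] [cite: MazurRubin2010, Prop. 3.3] [cite: GrossLMS1991, §3] -/
def TranspositionSupplyAtTwo : Prop :=
  ∀ (W : WeierstrassCurve ℚ) [W.IsElliptic] [W.IsGloballyMinimal] [NeZero (W.conductorNorm ℤ)],
    W.Δ < 0 → NoRationalTwoTorsion W → W.mordellWeilRank = 1 →
    ∃ (K : Type) (_ : Field K) (_ : NumberField K) (q₀ : ℕ) (_ : Fact q₀.Prime),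
      IsImaginaryQuadratic K ∧ TranspAdmissible W (NumberField.discr K) q₀ ∧ MeetsNonNormAt W q₀ ∧
      Nat.Coprime (NumberField.discr K).natAbs (W.conductorNorm ℤ) ∧
      SatisfiesHeegnerHypothesis (W.conductorNorm ℤ) K

/-- **Kernel-checked composition (the point of AN-24S).**  Door law AN-22K (`TranspositionDoorLawAtTwo`, tree,
conjecture) + supply AN-24S ⇒ on the `Δ < 0` locus of a rank-one curve there are an admissible Heegner field `K`
(Heegner hypothesis, `(d_K, N) = 1`) and a transposition prime `q₀ ∣ d_K` such that EVERY Heegner point of an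
odd-constant parametrisation datum over `K` is not twice up to torsion in `E(K)` (odd Heegner index) — with no door
bit left in the hypotheses.  At `Δ > 0` the analogous statement is FALSE as a schema (ε = −1 curves: every admissible
index is even, census 1 600/1 600), which is why the supply theorem is the `Δ < 0`-specific lever. -/
theorem exists_oddIndexDatum_of_doorLaw_of_supply
    (hL : TranspositionDoorLawAtTwo) (hS : TranspositionSupplyAtTwo)
    (W : WeierstrassCurve ℚ) [W.IsElliptic] [W.IsGloballyMinimal] [NeZero (W.conductorNorm ℤ)]
    (hr : W.mordellWeilRank = 1) (hloc : OnNegLocus W) :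
    ∃ (K : Type) (_ : Field K) (_ : NumberField K) (q₀ : ℕ) (_ : Fact q₀.Prime),
      IsImaginaryQuadratic K ∧ TranspAdmissible W (NumberField.discr K) q₀ ∧
      Nat.Coprime (NumberField.discr K).natAbs (W.conductorNorm ℤ) ∧
      SatisfiesHeegnerHypothesis (W.conductorNorm ℤ) K ∧
      ∀ (Dt : ModularParametrizationData W (W.conductorNorm ℤ))
        (H : HeegnerDatum (W.conductorNorm ℤ) (NumberField.discr K)) (ι : K →+* ℂ)
        (P : (W.baseChange K).toAffine.Point),
        WeierstrassCurve.Affine.Point.map ι.toRatAlgHom P = heegnerPointComplex Dt H →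
        ¬ (2 : ℤ) ∣ Dt.c → NotTwiceUpToTorsion W K P := by
  obtain ⟨K, iF, iN, q₀, iq, hK, hadm, hmeet, hcop, hHH⟩ := hS W hloc.1 hloc.2.1 hr
  refine ⟨K, iF, iN, q₀, iq, hK, hadm, hcop, hHH, ?_⟩
  intro Dt H ι P hP hc
  have hT : OnTranspLocus W q₀ := ⟨hloc.1, hloc.2.1, hloc.2.2.1, hmeet, hloc.2.2.2⟩
  exact notTwice_of_doorLaw hL W hr q₀ hT K hK hadm Dt H ι P hP hc

end Summit.BirchSwinnertonDyer.Rank1Residual.F1Sign2.SingleDoor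

end
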